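import Literature.Probability.LatticeModels.SourcedDoubleCurrents
import Literature.Probability.LatticeModels.DoubleCurrentsLimit
import Literature.Probability.LatticeModels.CurrentValueLaw
import Literature.Probability.Percolation.SiteConnectionTools
import HarnessLib

/-!
# Existence of the infinite-volume sourced double currents `P^{A,B}_β` — proof

Topic `Probability/LatticeModels`, namespace `Literature.Probability.LatticeModels`. This file
**discharges the named fact `sourcedDoubleCurrent_limit_exists`** of `SourcedDoubleCurrents.lean`:
for the nearest-neighbour Ising model on `ℤ^d`, `β > 0` and finite `A, B ⊂ ℤ^d` of even
cardinality, the finite-volume sourced double currents `P^{A,B}_{Λ_L,β}` (free boundary condition,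
read on the trace of `n₁ + n₂`) converge on every local event to a probability measure.

## Sources and what is formalised

* M. Aizenman, H. Duminil-Copin, Ann. of Math. 194 (2021), §3.2 (arXiv:1912.07973, p. 9): the
  existence is asserted there by reference — "Existing continuity results [ADS15] permit to extend
  (3.9) to the infinite volume, expressed in terms of the weak limits of the random current
  measures `P^A_{Λ_n,β}` and `P^{A_1,…,A_i}_{Λ_n,β}`, in the limit `Λ_n ↗ ℤ^d`".
  [AizenmanDuminilCopinAnnals2021]
* M. Aizenman, H. Duminil-Copin, V. Sidoravicius, Comm. Math. Phys. 334 (2015), Thm. 2.3 (R1)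
  and its proof (arXiv:1311.1937v3, pp. 8–9): `P̂_{Λ_L,β}[𝒞⁽⁰⁾_E] = Z(Λ_L ∖ E, β)/Z(Λ_L, β)
  = ⟨e^{-βK_E}⟩_{Λ_L,β}`, "The convergence of the above expression follows now directly from the
  convergence of correlation functions as `L` tends to infinity. The events `𝒞_E` … span (by
  inclusion–exclusion) the algebra of events expressible in terms of finite collections of the
  binary variables … implies the existence of `P̂_β`." [AizenmanDuminilCopinSidoraviciusCMP2015]

We run the printed ADS15 argument **with sources**, exactly parallel to the tree's sourceless
construction (`CurrentsEdgeAvoidance.lean` → `CurrentsTraceLaw.lean` → `DoubleCurrentsLimit.lean`):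

1. *Avoidance probabilities.* For `A ⊆ Λ_L` and lattice bonds `T ⊆ ℰ_{Λ_L}`,
   `P^A_{Λ_L,β}[n ≡ 0 on T] = Z_{Λ_L∖T}(A)/Z_{Λ_L}(A) = ⟨σ_A e^{-βK_T}⟩⁰_{Λ_L} / ⟨σ_A⟩⁰_{Λ_L}`
   (`sourcedAvoid_eq_div`, from the tree's sourced (2.13)–(2.14)
   `plusCurrentSumAvoid_div_eq_isingExpect_spinProduct` and `isingCorr_free_box_eq`). Numerator and
   denominator are finite combinations of free box correlations, which converge
   (`hasBoxLimit_isingCorr_free_holds`); the denominator tends to `⟨σ_A⟩⁰_β > 0` — positivity for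
   `β > 0` and `#A` even (`freeCorr_pos`): a current with sources `A` exists in a box containing
   `A` (pair the points of `A` by walks inside the box, `exists_current_sources_eq_of_even`), so
   `⟨σ_A⟩⁰_{Λ_L} > 0`, and `⟨σ_A⟩⁰_{Λ_L} ≤ ⟨σ_A⟩⁰_β` (Griffiths, `isingCorr_free_box_le_freeCorr`).
2. *Cylinders of one current* by inclusion–exclusion over avoidance events
   (`tsum_trace_eq_sum_pred`, `sourcedTrace_eq_sum`).
3. *The double current* `P^{A,B}_{Λ_L,β} = P^A ⊗ P^B` factorises on the cylinders `{ω ∩ F = U}`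
   (`sourcedDoubleCurrentLaw_real_localCylinder_eq`), hence its cylinder probabilities converge
   (`exists_tendsto_sourcedDoubleCurrentLaw_localCylinder`).
4. *Kolmogorov extension*, stated once for an arbitrary sequence of probability measures on bond
   configurations of `ℤ^d` with convergent cylinder probabilities
   (`exists_localLimit_of_tendsto_localCylinder`; the tree's `exists_isProjectiveLimit_holds`), and
   the assembly `sourcedDoubleCurrent_limit_exists_holds` (the laws are probability measures once
   `A, B ⊆ Λ_L`, so the sequence is shifted by such an `L₀`).

The result holds for every `β > 0`; the fact's hypotheses `2 ≤ d`, `β ≤ β_c(d)` are not used.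
No new definitions: all intermediate objects are written out (theorems only).
-/

noncomputable section

open MeasureTheory Filter Topology Finset Literature.Probability.Percolation
open scoped symmDiff ENNReal

namespace Literature.Probability.LatticeModels

/-! ### Local limits from cylinder limits (Kolmogorov extension), general form -/

section LocalLimit

variable {d : ℕ}

/-- Cylinder limits are nonnegative. [folklore] -/
theorem cylLimit_nonneg {P : ℕ → Measure (BondConfig (Site d))}
    {q : Finset (Sym2 (Site d)) → Finset (Sym2 (Site d)) → ℝ}
    (hq : ∀ ⦃F U : Finset (Sym2 (Site d))⦄, U ⊆ F →
      Tendsto (fun L : ℕ => (P L).real (localCylinder (↑F : Set (Sym2 (Site d))) ↑U)) atTop (𝓝 (q F U)))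
    {F U : Finset (Sym2 (Site d))} (hUF : U ⊆ F) : 0 ≤ q F U :=
  ge_of_tendsto' (hq hUF) fun _ => measureReal_nonneg

/-- **Normalisation** of cylinder limits of probability measures: `∑_{U ⊆ F} q(F,U) = 1`. [folklore] -/
theorem sum_cylLimit {P : ℕ → Measure (BondConfig (Site d))} (hP : ∀ L, IsProbabilityMeasure (P L))
    {q : Finset (Sym2 (Site d)) → Finset (Sym2 (Site d)) → ℝ}
    (hq : ∀ ⦃F U : Finset (Sym2 (Site d))⦄, U ⊆ F →
      Tendsto (fun L : ℕ => (P L).real (localCylinder (↑F : Set (Sym2 (Site d))) ↑U)) atTop (𝓝 (q F U)))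
    (F : Finset (Sym2 (Site d))) : ∑ U ∈ F.powerset, q F U = 1 := by
  have hL : ∀ L : ℕ, ∑ U ∈ F.powerset, (P L).real (localCylinder (↑F : Set (Sym2 (Site d))) ↑U) = 1 := by
    intro L
    haveI := hP L
    have h := measureReal_eq_sum_localCylinder d (P L) (A := Set.univ)
      (determinedBy_univ (↑F : Set (Sym2 (Site d))))
    rw [probReal_univ] at h
    simp only [Set.mem_univ, Finset.filter_true] at h
    exact h.symm
  have ht : Tendsto (fun L : ℕ => ∑ U ∈ F.powerset, (P L).real (localCylinder (↑F : Set (Sym2 (Site d))) ↑U))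
      atTop (𝓝 (∑ U ∈ F.powerset, q F U)) :=
    tendsto_finsetSum _ fun U hU => hq (Finset.mem_powerset.1 hU)
  simp_rw [hL] at ht
  exact tendsto_nhds_unique ht tendsto_const_nhds

/-- **Consistency** of cylinder limits: for `J ⊆ I` and `U' ⊆ J`,
`q(J,U') = ∑_{U ⊆ I, U ∩ J = U'} q(I,U)`. [folklore] -/
theorem cylLimit_eq_sum {P : ℕ → Measure (BondConfig (Site d))} (hP : ∀ L, IsProbabilityMeasure (P L))
    {q : Finset (Sym2 (Site d)) → Finset (Sym2 (Site d)) → ℝ}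
    (hq : ∀ ⦃F U : Finset (Sym2 (Site d))⦄, U ⊆ F →
      Tendsto (fun L : ℕ => (P L).real (localCylinder (↑F : Set (Sym2 (Site d))) ↑U)) atTop (𝓝 (q F U)))
    {I J : Finset (Sym2 (Site d))} (hJI : J ⊆ I) {U' : Finset (Sym2 (Site d))} (hU' : U' ⊆ J) :
    q J U' = ∑ U ∈ I.powerset.filter (fun U => U ∩ J = U'), q I U := by
  classical
  have hfil : I.powerset.filter (fun U : Finset (Sym2 (Site d)) =>
      (↑U : Set (Sym2 (Site d))) ∈ localCylinder (↑J : Set (Sym2 (Site d))) ↑U') =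
      I.powerset.filter (fun U => U ∩ J = U') :=
    Finset.filter_congr fun U _ => coe_mem_localCylinder_iff d hU'
  have hL : ∀ L : ℕ, (P L).real (localCylinder (↑J : Set (Sym2 (Site d))) ↑U') =
      ∑ U ∈ I.powerset.filter (fun U => U ∩ J = U'),
        (P L).real (localCylinder (↑I : Set (Sym2 (Site d))) ↑U) := by
    intro L
    haveI := hP L
    rw [← hfil]
    exact measureReal_eq_sum_localCylinder d _
      ((determinedBy_localCylinder _ _).mono (Finset.coe_subset.2 hJI))
  have h1 := hq hU'
  simp_rw [hL] at h1
  have h2 : Tendsto (fun L : ℕ => ∑ U ∈ I.powerset.filter (fun U => U ∩ J = U'),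
      (P L).real (localCylinder (↑I : Set (Sym2 (Site d))) ↑U)) atTop
      (𝓝 (∑ U ∈ I.powerset.filter (fun U => U ∩ J = U'), q I U)) :=
    tendsto_finsetSum _ fun U hU => hq (Finset.mem_powerset.1 (Finset.mem_of_mem_filter U hU))
  exact tendsto_nhds_unique h1 h2

/-- The candidate finite-dimensional laws `∑_{U ⊆ J} q(J,U) δ_{χ_U}` on `J → Bool`, evaluated on a
set. [folklore] -/
theorem cylFamily_apply (q : Finset (Sym2 (Site d)) → Finset (Sym2 (Site d)) → ℝ)
    (J : Finset (Sym2 (Site d))) (s : Set (J → Bool)) :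
    (∑ U ∈ J.powerset, ENNReal.ofReal (q J U) • Measure.dirac (bondCoordPoint d J U)) s =
      ∑ U ∈ J.powerset, ENNReal.ofReal (q J U) * s.indicator 1 (bondCoordPoint d J U) := by
  rw [Measure.finsetSum_apply]
  refine Finset.sum_congr rfl fun U _ => ?_
  rw [Measure.smul_apply, Measure.dirac_apply, smul_eq_mul]

/-- The candidate finite-dimensional laws are probability measures. [folklore] -/
theorem isProbabilityMeasure_cylFamily {P : ℕ → Measure (BondConfig (Site d))}
    (hP : ∀ L, IsProbabilityMeasure (P L))
    {q : Finset (Sym2 (Site d)) → Finset (Sym2 (Site d)) → ℝ}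
    (hq : ∀ ⦃F U : Finset (Sym2 (Site d))⦄, U ⊆ F →
      Tendsto (fun L : ℕ => (P L).real (localCylinder (↑F : Set (Sym2 (Site d))) ↑U)) atTop (𝓝 (q F U)))
    (J : Finset (Sym2 (Site d))) :
    IsProbabilityMeasure (∑ U ∈ J.powerset, ENNReal.ofReal (q J U) • Measure.dirac (bondCoordPoint d J U)) := by
  constructor
  rw [cylFamily_apply]
  simp only [Set.indicator_univ, Pi.one_apply, mul_one]
  rw [← ENNReal.ofReal_sum_of_nonneg fun U hU => cylLimit_nonneg hq (Finset.mem_powerset.1 hU),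
    sum_cylLimit hP hq, ENNReal.ofReal_one]

/-- **The candidate finite-dimensional laws form a projective family** (consistency,
`cylLimit_eq_sum`). [folklore] -/
theorem isProjectiveMeasureFamily_cylFamily {P : ℕ → Measure (BondConfig (Site d))}
    (hP : ∀ L, IsProbabilityMeasure (P L))
    {q : Finset (Sym2 (Site d)) → Finset (Sym2 (Site d)) → ℝ}
    (hq : ∀ ⦃F U : Finset (Sym2 (Site d))⦄, U ⊆ F →
      Tendsto (fun L : ℕ => (P L).real (localCylinder (↑F : Set (Sym2 (Site d))) ↑U)) atTop (𝓝 (q F U))) :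
    IsProjectiveMeasureFamily (α := fun _ : Sym2 (Site d) => Bool)
      (fun J => ∑ U ∈ J.powerset, ENNReal.ofReal (q J U) • Measure.dirac (bondCoordPoint d J U)) := by
  classical
  intro I J hJI
  dsimp only
  ext s hs
  rw [Measure.map_apply (Finset.measurable_restrict₂ hJI) hs, cylFamily_apply, cylFamily_apply]
  have hind : ∀ U, (Finset.restrict₂ (π := fun _ : Sym2 (Site d) => Bool) hJI ⁻¹' s).indicator
      (1 : (I → Bool) → ℝ≥0∞) (bondCoordPoint d I U) = s.indicator 1 (bondCoordPoint d J (U ∩ J)) := by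
    intro U
    simp only [Set.indicator_apply, Set.mem_preimage, restrict₂_bondCoordPoint d hJI, Pi.one_apply]
  simp_rw [hind]
  rw [← Finset.sum_fiberwise_of_maps_to (s := I.powerset) (t := J.powerset) (g := fun U => U ∩ J)
    (fun U _ => Finset.mem_powerset.2 Finset.inter_subset_right)]
  refine Finset.sum_congr rfl fun U' hU' => ?_
  rw [cylLimit_eq_sum hP hq hJI (Finset.mem_powerset.1 hU'),
    ENNReal.ofReal_sum_of_nonneg fun U hU =>
      cylLimit_nonneg hq (Finset.mem_powerset.1 (Finset.mem_of_mem_filter U hU)),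
    Finset.sum_mul]
  refine Finset.sum_congr rfl fun U hU => ?_
  rw [(Finset.mem_filter.1 hU).2]

/-- **Local weak limits from cylinder limits.** If `(P_L)` is a sequence of probability measures
on bond configurations of `ℤ^d` whose probabilities of the cylinders `{ω ∩ F = U}` converge for
every finite `F` and `U ⊆ F`, then there is a probability measure `μ` with `P_L[S] → μ[S]` for
every local event `S`: the limits form a projective family of laws on the `J → Bool`, whose
Kolmogorov extension (the tree's `exists_isProjectiveLimit_holds`; `Bool` is Polish), transported
to bond configurations, charges each cylinder with its limit, and a local event is a finite
disjoint union of cylinders. (The step "inclusion–exclusion spans the local algebra … implies the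
existence of `P̂_β`" of the ADS15 proof of Thm. 2.3 (R1), in general form.) [cite: AizenmanDuminilCopinSidoraviciusCMP2015, Thm. 2.3 (R1), proof] -/
theorem exists_localLimit_of_tendsto_localCylinder {P : ℕ → Measure (BondConfig (Site d))}
    (hP : ∀ L, IsProbabilityMeasure (P L))
    {q : Finset (Sym2 (Site d)) → Finset (Sym2 (Site d)) → ℝ}
    (hq : ∀ ⦃F U : Finset (Sym2 (Site d))⦄, U ⊆ F →
      Tendsto (fun L : ℕ => (P L).real (localCylinder (↑F : Set (Sym2 (Site d))) ↑U)) atTop (𝓝 (q F U))) :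
    ∃ μ : Measure (BondConfig (Site d)), IsProbabilityMeasure μ ∧
      ∀ S : Set (BondConfig (Site d)), IsLocalEvent S →
        Tendsto (fun L : ℕ => (P L).real S) atTop (𝓝 (μ.real S)) := by
  classical
  have hfam := isProjectiveMeasureFamily_cylFamily hP hq
  haveI : ∀ J : Finset (Sym2 (Site d)), IsProbabilityMeasure
      (∑ U ∈ J.powerset, ENNReal.ofReal (q J U) • Measure.dirac (bondCoordPoint d J U)) := fun J =>
    isProbabilityMeasure_cylFamily hP hq J
  haveI : ∀ i : Sym2 (Site d), PolishSpace ((fun _ : Sym2 (Site d) => Bool) i) := fun _ =>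
    inferInstanceAs (PolishSpace Bool)
  haveI : ∀ i : Sym2 (Site d), BorelSpace ((fun _ : Sym2 (Site d) => Bool) i) := fun _ =>
    inferInstanceAs (BorelSpace Bool)
  obtain ⟨ν, hν⟩ := Literature.Probability.Process.exists_isProjectiveLimit_holds
    (α := fun _ : Sym2 (Site d) => Bool)
    (P := fun J => ∑ U ∈ J.powerset, ENNReal.ofReal (q J U) • Measure.dirac (bondCoordPoint d J U)) hfam
  haveI := hν.isProbabilityMeasure
  set μ : Measure (BondConfig (Site d)) := ν.map (boolToBondConfig d) with hμ
  haveI : IsProbabilityMeasure μ :=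
    Measure.isProbabilityMeasure_map (measurable_boolToBondConfig d).aemeasurable
  -- `μ` charges the cylinders with `q(F,U)`
  have hμU : ∀ {F U : Finset (Sym2 (Site d))}, U ⊆ F →
      μ.real (localCylinder (↑F : Set (Sym2 (Site d))) ↑U) = q F U := by
    intro F U hU
    rw [measureReal_def, hμ, Measure.map_apply (measurable_boolToBondConfig d)
        (measurableSet_localCylinder_coe d F ↑U),
      preimage_boolToBondConfig_localCylinder,
      ← Measure.map_apply (Finset.measurable_restrict (X := fun _ : Sym2 (Site d) => Bool) F)
        (measurableSet_singleton _), hν F]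
    dsimp only
    rw [cylFamily_apply]
    rw [Finset.sum_eq_single_of_mem U (Finset.mem_powerset.2 hU) fun U' hU' hne => by
      rw [Set.indicator_of_notMem, mul_zero]
      rw [Set.mem_singleton_iff]
      exact fun h => hne (bondCoordPoint_injective d (Finset.mem_powerset.1 hU') hU h)]
    rw [Set.indicator_of_mem (Set.mem_singleton _), Pi.one_apply, mul_one,
      ENNReal.toReal_ofReal (cylLimit_nonneg hq hU)]
  refine ⟨μ, inferInstance, ?_⟩
  rintro S ⟨F, hF⟩
  rw [measureReal_eq_sum_localCylinder d μ hF]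
  have hLsum : ∀ L : ℕ, (P L).real S =
      ∑ U ∈ F.powerset.filter (fun U : Finset (Sym2 (Site d)) => (↑U : Set (Sym2 (Site d))) ∈ S),
        (P L).real (localCylinder (↑F : Set (Sym2 (Site d))) ↑U) := by
    intro L
    haveI := hP L
    exact measureReal_eq_sum_localCylinder d _ hF
  simp_rw [hLsum]
  have hlim : ∑ U ∈ F.powerset.filter (fun U : Finset (Sym2 (Site d)) => (↑U : Set (Sym2 (Site d))) ∈ S),
        μ.real (localCylinder (↑F : Set (Sym2 (Site d))) ↑U) =
      ∑ U ∈ F.powerset.filter (fun U : Finset (Sym2 (Site d)) => (↑U : Set (Sym2 (Site d))) ∈ S),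
        q F U :=
    Finset.sum_congr rfl fun U hU => hμU (Finset.mem_powerset.1 (Finset.mem_of_mem_filter U hU))
  rw [hlim]
  exact tendsto_finsetSum _ fun U hU => hq (Finset.mem_powerset.1 (Finset.mem_of_mem_filter U hU))

end LocalLimit

/-! ### Inclusion–exclusion with prescribed sources, and currents with prescribed sources -/

section SingleCurrent

variable {V : Type*} [Fintype V] [DecidableEq V] (G : SimpleGraph V) [DecidableRel G.Adj]

omit [DecidableEq V] in
open Classical in
/-- **Inclusion–exclusion at the level of the generating sums**, for an arbitrary constraint `P`
on the current (e.g. prescribed sources): for `U ⊆ F` and a trace map `tr`,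
`∑_{P(n), tr(n) ∩ F = U} w = ∑_{W ⊆ U} (-1)^{|W|} ∑_{P(n), tr(n) avoids (F∖U) ∪ W} w`
(the tree's `tsum_trace_eq_sum` is the case `P(n) = (∂n ∩ Λ = ∅)`; trace analogue of the
inclusion–exclusion step of the ADS15 proof of Thm. 2.3 (R1)). [cite: AizenmanDuminilCopinSidoraviciusCMP2015, Thm. 2.3 (R1), proof (trace analogue)] -/
theorem tsum_trace_eq_sum_pred {α : Type*} [DecidableEq α] (β : ℝ) (P : Current G → Prop)
    [DecidablePred P] (tr : Current G → Set α) {F U : Finset α} (hUF : U ⊆ F) :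
    ∑' n : Current G, (if P n ∧ ∀ e ∈ F, (e ∈ U ↔ e ∈ tr n) then n.weight β else 0) =
      ∑ W ∈ U.powerset, (-1 : ℝ) ^ #W *
        ∑' n : Current G, (if P n ∧ ∀ e ∈ (F \ U) ∪ W, e ∉ tr n then n.weight β else 0) := by
  have hterm : ∀ n : Current G,
      (if P n ∧ ∀ e ∈ F, (e ∈ U ↔ e ∈ tr n) then n.weight β else 0) =
      ∑ W ∈ U.powerset, (-1 : ℝ) ^ #W *
        (if P n ∧ ∀ e ∈ (F \ U) ∪ W, e ∉ tr n then n.weight β else 0) := by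
    intro n
    by_cases hs : P n
    · have key := indicator_trace_eq_sum (tr n) hUF
      have hl : (if P n ∧ ∀ e ∈ F, (e ∈ U ↔ e ∈ tr n) then n.weight β else 0) =
          n.weight β * (if ∀ e ∈ F, (e ∈ U ↔ e ∈ tr n) then (1 : ℝ) else 0) := by
        by_cases h2 : ∀ e ∈ F, (e ∈ U ↔ e ∈ tr n)
        · rw [if_pos ⟨hs, h2⟩, if_pos h2, mul_one]
        · rw [if_neg (fun h => h2 h.2), if_neg h2, mul_zero]
      have hr : ∀ W : Finset α, (if P n ∧ ∀ e ∈ (F \ U) ∪ W, e ∉ tr n then n.weight β else 0)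
          = n.weight β * (if ∀ e ∈ (F \ U) ∪ W, e ∉ tr n then (1 : ℝ) else 0) := by
        intro W
        by_cases h2 : ∀ e ∈ (F \ U) ∪ W, e ∉ tr n
        · rw [if_pos ⟨hs, h2⟩, if_pos h2, mul_one]
        · rw [if_neg (fun h => h2 h.2), if_neg h2, mul_zero]
      rw [hl, key, Finset.mul_sum]
      refine Finset.sum_congr rfl fun W _ => ?_
      rw [hr W]; ring
    · rw [if_neg (fun h => hs h.1)]
      symm
      refine Finset.sum_eq_zero fun W _ => ?_
      rw [if_neg (fun h => hs h.1), mul_zero]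
  simp_rw [hterm]
  rw [Summable.tsum_finsetSum (fun W _ => (summable_ite_weight G β _).mul_left _)]
  refine Finset.sum_congr rfl fun W _ => ?_
  exact tsum_mul_left

/-- **A walk carries a current whose sources are its endpoints**: summing the unit currents of the
edges of a walk from `x` to `y` (with multiplicity) gives a current `n` with `∂n = {x} ∆ {y}`
(`∂(n₁ + n₂) = ∂n₁ ∆ ∂n₂`, telescoping). [folklore] -/
theorem exists_current_sources_eq_of_walk {x y : V} (p : G.Walk x y) :
    ∃ n : Current G, n.sources = {x} ∆ {y} := by
  induction p with
  | nil => exact ⟨0, by rw [Current.sources_zero, symmDiff_self, Finset.bot_eq_empty]⟩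
  | @cons u v w huv p ih =>
    obtain ⟨n, hn⟩ := ih
    have he : s(u, v) ∈ G.edgeFinset := SimpleGraph.mem_edgeFinset.2 huv
    refine ⟨Pi.single ⟨s(u, v), he⟩ 1 + n, ?_⟩
    rw [Current.sources_add, hn, Current.sources_single ⟨s(u, v), he⟩ rfl,
      ← Current.symmDiff_singleton_eq_pair huv.ne, symmDiff_assoc, symmDiff_symmDiff_cancel_left]

omit [DecidableEq V] in
/-- Current weights are positive for `β > 0`. [folklore] -/
theorem Current.weight_pos_of_pos {β : ℝ} (hβ : 0 < β) (n : Current G) : 0 < n.weight β :=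
  Finset.prod_pos fun _ _ => div_pos (pow_pos hβ _) (Nat.cast_pos.2 (Nat.factorial_pos _))

/-- **If a current with sources `A` exists, `∑_{∂n = A} w_β(n) > 0`** (`β > 0`). [folklore] -/
theorem currentSum_pos_of_exists {β : ℝ} (hβ : 0 < β) {A : Finset V}
    (h : ∃ n : Current G, n.sources = A) : 0 < currentSum G β A := by
  obtain ⟨n, hn⟩ := h
  unfold currentSum
  refine (summable_currentWeight_indicator_holds G β A).tsum_pos (fun m => ?_) n ?_
  · split_ifs
    · exact Current.weight_nonneg hβ.le m
    · exact le_rfl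
  · rw [if_pos hn]
    exact Current.weight_pos_of_pos G hβ n

end SingleCurrent

/-! ### The free box graph: walks, currents with even sources, positivity of correlations -/

section Box

variable (d : ℕ)

/-- Two vertices of `Λ_L` are joined by a walk of the free box graph (a nearest-neighbour path
inside the box, the tree's `box_induce_reachable`). [folklore] -/
theorem freeBoxGraph_reachable {L : ℕ} {x y : BoxVertex d L} (hx : (x : Site d) ∈ box d L)
    (hy : (y : Site d) ∈ box d L) : (freeBoxGraph d L).Reachable x y := by
  let φ : (zdGraph d).induce (↑(box d L) : Set (Site d)) →g freeBoxGraph d L :=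
    { toFun := fun v => ⟨v.1, box_subset_box_succ d L v.2⟩
      map_rel' := fun {a b} hab => by
        simp only [SimpleGraph.comap_adj, Function.Embedding.coe_subtype] at hab
        exact ⟨hab, a.2, b.2⟩ }
  exact (box_induce_reachable L hx hy).map φ

/-- **Currents with prescribed even sources exist**: for every `A' ⊆ Λ_L` of even cardinality
there is a current of the free box graph with `∂n = A'` (pair the points of `A'` by walks inside
the box). [folklore] -/
theorem exists_current_sources_eq_of_even {L : ℕ} (A' : Finset (BoxVertex d L))
    (hA' : A' ⊆ boxCore d L) (heven : Even #A') :
    ∃ n : Current (freeBoxGraph d L), n.sources = A' := by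
  induction A' using Finset.strongInduction with
  | H A' ih =>
    rcases A'.eq_empty_or_nonempty with rfl | ⟨a, ha⟩
    · exact ⟨0, Current.sources_zero⟩
    · have h2 : 1 < #A' := by
        have h1 : 1 ≤ #A' := Finset.card_pos.2 ⟨a, ha⟩
        obtain ⟨k, hk⟩ := heven
        omega
      obtain ⟨b, hb, hba⟩ := Finset.exists_mem_ne h2 a
      have hsub : ({a, b} : Finset (BoxVertex d L)) ⊆ A' := by
        intro z hz
        rcases Finset.mem_insert.1 hz with rfl | hz
        · exact ha
        · rw [Finset.mem_singleton.1 hz]; exact hb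
      have hss : A' \ {a, b} ⊂ A' := Finset.sdiff_ssubset hsub ⟨a, Finset.mem_insert_self a _⟩
      have hcard : #(A' \ {a, b}) = #A' - 2 := by
        rw [Finset.card_sdiff_of_subset hsub, Finset.card_pair hba.symm]
      have heven' : Even #(A' \ {a, b}) := by
        rw [hcard]
        obtain ⟨k, hk⟩ := heven
        exact ⟨k - 1, by omega⟩
      obtain ⟨m, hm⟩ := ih (A' \ {a, b}) hss (fun z hz => hA' (Finset.sdiff_subset hz)) heven'
      obtain ⟨p⟩ := freeBoxGraph_reachable d ((mem_boxCore d).1 (hA' ha)) ((mem_boxCore d).1 (hA' hb))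
      obtain ⟨k, hk⟩ := exists_current_sources_eq_of_walk _ p
      refine ⟨k + m, ?_⟩
      rw [Current.sources_add, hk, hm, Current.symmDiff_singleton_eq_pair hba.symm,
        Finset.disjoint_sdiff.symmDiff_eq_sup, Finset.sup_eq_union, Finset.union_sdiff_of_subset hsub]

variable {d}

/-- Sources inside `Λ_L` lie in `boxCore`. [folklore] -/
theorem boxSources_subset_boxCore {L : ℕ} {A : Finset (Site d)} (hA : A ⊆ box d L) :
    boxSources d L A ⊆ boxCore d L :=
  fun _ ha => (mem_boxCore d).2 (hA (mem_boxSources_iff.1 ha))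

/-- For `A ⊆ Λ_L`, `boxSources d L A` maps back onto `A`. [folklore] -/
theorem map_boxSources {L : ℕ} {A : Finset (Site d)} (hA : A ⊆ box d L) :
    (boxSources d L A).map (boxEmb d L) = A :=
  map_filter_val_mem hA

/-- For `A ⊆ Λ_L`, `boxSources d L A` has the cardinality of `A`. [folklore] -/
theorem card_boxSources {L : ℕ} {A : Finset (Site d)} (hA : A ⊆ box d L) :
    #(boxSources d L A) = #A := by
  conv_rhs => rw [← map_boxSources hA]
  rw [Finset.card_map]

variable (d)

/-- On the free box graph the `+` generating sums of `boxCore` are the plain ones: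
`Z⁺_{boxCore}(A') = ∑_{∂n = A'} w_β(n)` (all sources lie in `boxCore`). [folklore] -/
theorem plusCurrentSum_freeBoxGraph_eq_currentSum (L : ℕ) (β : ℝ) (A' : Finset (BoxVertex d L)) :
    plusCurrentSum (freeBoxGraph d L) (boxCore d L) β A' = currentSum (freeBoxGraph d L) β A' := by
  unfold plusCurrentSum currentSum
  refine tsum_congr fun n => ?_
  rw [Finset.inter_eq_left.2 (sources_subset_boxCore d n)]

/-- **`Z_{Λ_L}(A) > 0`**: for `β > 0` and `A ⊆ Λ_L` of even cardinality the generating sum of free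
currents of `Λ_L` with sources `A` is positive. [folklore] -/
theorem currentSum_boxSources_pos {L : ℕ} {β : ℝ} (hβ : 0 < β) {A : Finset (Site d)}
    (hA : A ⊆ box d L) (heven : Even #A) :
    0 < currentSum (freeBoxGraph d L) β (boxSources d L A) :=
  currentSum_pos_of_exists _ hβ
    (exists_current_sources_eq_of_even d _ (boxSources_subset_boxCore hA) (by rwa [card_boxSources hA]))

/-- **`⟨σ_A⟩⁰_{Λ_L;β,0} > 0`** for `β > 0` and `A ⊆ Λ_L` of even cardinality (random-current
representation `⟨σ_A⟩⁰ = Z(A)/Z(∅)`, `isingCorr_free_box_eq`, and `Z(A) > 0`). [folklore] -/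
theorem isingCorr_free_box_pos {L : ℕ} {β : ℝ} (hβ : 0 < β) {A : Finset (Site d)}
    (hA : A ⊆ box d L) (heven : Even #A) :
    0 < isingCorr (zdGraph d) (box d L) β 0 .free A := by
  have h := isingCorr_free_box_eq d L β (boxSources_subset_boxCore hA)
  rw [map_boxSources hA] at h
  rw [h, plusCurrentSum_freeBoxGraph_eq_currentSum, plusCurrentSum_freeBoxGraph_eq_currentSum]
  exact div_pos (currentSum_boxSources_pos d hβ hA heven) (currentSum_empty_pos' _ β)

/-- **`⟨σ_A⟩⁰_β > 0`** for `β > 0` and `#A` even (free state; Griffiths' monotonicity in the volume,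
`isingCorr_free_box_le_freeCorr`, and positivity in a box containing `A`). [folklore] -/
theorem freeCorr_pos {β : ℝ} (hβ : 0 < β) {A : Finset (Site d)} (heven : Even #A) :
    0 < freeCorr d β 0 A := by
  obtain ⟨L₀, hL₀⟩ := exists_forall_subset_box d A
  exact (isingCorr_free_box_pos d hβ (hL₀ L₀ le_rfl) heven).trans_le
    (isingCorr_free_box_le_freeCorr hβ.le le_rfl (hL₀ L₀ le_rfl))

/-! ### The avoidance probabilities of the sourced free current of a box -/

/-- **ADS15 (2.13)–(2.14) with sources, in the box**: for `A ⊆ Λ_L`, lattice bonds `T ⊆ ℰ_{Λ_L}`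
and every real `β`,
`P^A_{Λ_L,β}[n ≡ 0 on T] = Z_{Λ_L∖T}(A)/Z_{Λ_L}(A) = ⟨σ_A e^{-βK_T}⟩⁰_{Λ_L;β,0} / ⟨σ_A⟩⁰_{Λ_L;β,0}`
(the tree's sourced identity `plusCurrentSumAvoid_div_eq_isingExpect_spinProduct`, transported from
the free box graph to `Λ_L ⊂ ℤ^d` as in `freeCurrentAvoidProb_eq_isingExpect`, divided by the
representation `⟨σ_A⟩⁰_{Λ_L} = Z(A)/Z(∅)`). [cite: AizenmanDuminilCopinSidoraviciusCMP2015, §2.2, eqs. (2.13)–(2.14)] -/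
theorem sourcedAvoid_eq_div (L : ℕ) (β : ℝ) {T : Finset (Sym2 (Site d))}
    (hT : T ⊆ edgesIn (zdGraph d) (box d L)) {A : Finset (Site d)} (hA : A ⊆ box d L) :
    plusCurrentSumAvoid (freeBoxGraph d L) (boxCore d L) β (freeBoxBonds d L T) (boxSources d L A) /
        plusCurrentSum (freeBoxGraph d L) (boxCore d L) β (boxSources d L A) =
      isingExpect (zdGraph d) (box d L) β 0 .free (fun σ => spinProduct A σ * expNegBonds d β T σ) /
        isingCorr (zdGraph d) (box d L) β 0 .free A := by
  have hA' := boxSources_subset_boxCore hA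
  have hTG : freeBoxBonds d L T ⊆ (freeBoxGraph d L).edgeFinset := Finset.filter_subset _ _
  set A' := boxSources d L A with hA'def
  have hadj : ∀ x ∈ boxCore d L, ∀ y ∈ boxCore d L,
      ((zdGraph d).Adj (boxEmb d L x) (boxEmb d L y) ↔ (freeBoxGraph d L).Adj x y) := by
    intro x hx y hy
    rw [freeBoxGraph_adj, boxEmb_apply, boxEmb_apply]
    exact ⟨fun h => ⟨h, (mem_boxCore d).1 hx, (mem_boxCore d).1 hy⟩, fun h => h.1⟩
  have hmeas : Measurable fun σ : SpinConfig (Site d) => spinProduct A σ * expNegBonds d β T σ :=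
    (measurable_spinProduct _).mul (measurable_expNegBonds d β T)
  have hnum : isingExpect (zdGraph d) (box d L) β 0 .free (fun σ => spinProduct A σ * expNegBonds d β T σ) =
      plusCurrentSumAvoid (freeBoxGraph d L) (boxCore d L) β (freeBoxBonds d L T) A' /
        plusCurrentSum (freeBoxGraph d L) (boxCore d L) β ∅ := by
    have htrans := isingExpect_free_map (G := freeBoxGraph d L) (boxEmb d L) hadj β 0 hmeas
    rw [map_boxCore d L] at htrans
    have hf : (fun σ : SpinConfig (BoxVertex d L) =>
        spinProduct A (SpinConfig.extendAlong (boxEmb d L) σ) *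
          expNegBonds d β T (SpinConfig.extendAlong (boxEmb d L) σ)) =
        fun σ => spinProduct A' σ * Real.exp (-β * ∑ e ∈ freeBoxBonds d L T, bondSpin σ e) := by
      funext σ
      rw [← map_boxSources hA, spinProduct_map_extendAlong, expNegBonds, ← sum_freeBoxBonds_eq d hT]
      congr 3
      exact Finset.sum_congr rfl fun e' _ => bondSpin_extendAlong_map (boxEmb d L) σ e'
    rw [htrans, hf, isingExpect_free_eq_plus_of_edgesIn_eq _ (edgesIn_freeBoxGraph d L),
      plusCurrentSumAvoid_div_eq_isingExpect_spinProduct (freeBoxGraph d L)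
        (edgesTouching_freeBoxGraph d L) hTG β hA']
  have hden := isingCorr_free_box_eq d L β hA'
  rw [map_boxSources hA] at hden
  rw [hnum, hden, div_div_div_cancel_right₀
    (plusCurrentSum_empty_pos (freeBoxGraph d L) (edgesTouching_freeBoxGraph d L) β).ne']

/-- **Convergence of the sourced avoidance probabilities** ("the convergence of the above
expression follows now directly from the convergence of correlation functions as `L` tends to
infinity", ADS15 proof of Thm. 2.3 (R1), here with sources): for `β > 0`, a finite set `T` of
lattice bonds and `#A` even,
`P^A_{Λ_L,β}[n ≡ 0 on T] → (∑_{R ⊆ T} cosh(β)^{|T|} (-sinh β)^{|R|}/cosh(β)^{|R|} ⟨σ_{A ∆ A(R)}⟩⁰_β) / ⟨σ_A⟩⁰_β`,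
by the existence of the free state on spin products and `⟨σ_A⟩⁰_β > 0`. [cite: AizenmanDuminilCopinSidoraviciusCMP2015, Thm. 2.3 (R1), proof] -/
theorem tendsto_sourcedAvoid {β : ℝ} (hβ : 0 < β) {T : Finset (Sym2 (Site d))}
    (hT : ↑T ⊆ (zdGraph d).edgeSet) {A : Finset (Site d)} (heven : Even #A) :
    Tendsto (fun L : ℕ =>
        plusCurrentSumAvoid (freeBoxGraph d L) (boxCore d L) β (freeBoxBonds d L T) (boxSources d L A) /
          plusCurrentSum (freeBoxGraph d L) (boxCore d L) β (boxSources d L A)) atTop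
      (𝓝 ((∑ R ∈ T.powerset, Real.cosh β ^ #T * (-Real.sinh β) ^ #R / Real.cosh β ^ #R *
          freeCorr d β 0 (A ∆ bondsSupport d R)) / freeCorr d β 0 A)) := by
  have hdiag : ∀ e ∈ T, ¬e.IsDiag := fun e he => not_isDiag_of_mem_edgeSet d (hT he)
  have hnum : Tendsto (fun L : ℕ => isingExpect (zdGraph d) (box d L) β 0 .free
      (fun σ => spinProduct A σ * expNegBonds d β T σ)) atTop
      (𝓝 (∑ R ∈ T.powerset, Real.cosh β ^ #T * (-Real.sinh β) ^ #R / Real.cosh β ^ #R *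
        freeCorr d β 0 (A ∆ bondsSupport d R))) := by
    simp_rw [isingExpect_spinProduct_expNegBonds_eq_sum _ β 0 .free _ hdiag]
    exact tendsto_finsetSum _ fun R _ =>
      (hasBoxLimit_isingCorr_free_holds hβ.le le_rfl (A ∆ bondsSupport d R)).const_mul _
  have hden : Tendsto (fun L : ℕ => isingCorr (zdGraph d) (box d L) β 0 .free A) atTop
      (𝓝 (freeCorr d β 0 A)) :=
    hasBoxLimit_isingCorr_free_holds hβ.le le_rfl A
  refine (hnum.div hden (freeCorr_pos d hβ heven).ne').congr' ?_
  obtain ⟨L₀, hL₀⟩ := exists_forall_subset_box d A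
  filter_upwards [eventually_subset_edgesIn d hT, eventually_ge_atTop L₀] with L hL hL'
  exact (sourcedAvoid_eq_div d L β hL (hL₀ L hL')).symm

/-! ### The law of the trace of one sourced current on finitely many bonds -/

open Classical in
/-- **`P^A_{Λ_L,β}[n̂ ∩ F = U] = ∑_{W ⊆ U} (-1)^{|W|} P^A_{Λ_L,β}[n ≡ 0 on (F ∖ U) ∪ W]`** for `U ⊆ F`
(inclusion–exclusion; the probabilities written as ratios of generating sums of free currents of
`Λ_L` with sources `A`). [cite: AizenmanDuminilCopinSidoraviciusCMP2015, Thm. 2.3 (R1), proof] -/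
theorem sourcedTrace_eq_sum (L : ℕ) (β : ℝ) (A : Finset (Site d)) {F U : Finset (Sym2 (Site d))}
    (hUF : U ⊆ F) :
    (∑' n : Current (freeBoxGraph d L),
        if n.sources = boxSources d L A ∧ ∀ e ∈ F, (e ∈ U ↔ e ∈ liftBonds d L n.traced)
        then n.weight β else 0) / currentSum (freeBoxGraph d L) β (boxSources d L A) =
      ∑ W ∈ U.powerset, (-1 : ℝ) ^ #W *
        (plusCurrentSumAvoid (freeBoxGraph d L) (boxCore d L) β (freeBoxBonds d L ((F \ U) ∪ W))
            (boxSources d L A) /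
          plusCurrentSum (freeBoxGraph d L) (boxCore d L) β (boxSources d L A)) := by
  have h := tsum_trace_eq_sum_pred (freeBoxGraph d L) β (fun n => n.sources = boxSources d L A)
    (fun n => liftBonds d L n.traced) hUF
  have h1 : ∀ n : Current (freeBoxGraph d L), n.sources ∩ boxCore d L = n.sources := fun n =>
    Finset.inter_eq_left.2 (sources_subset_boxCore d n)
  rw [h, Finset.sum_div, plusCurrentSum_freeBoxGraph_eq_currentSum]
  refine Finset.sum_congr rfl fun W _ => ?_
  have h2 : plusCurrentSumAvoid (freeBoxGraph d L) (boxCore d L) β (freeBoxBonds d L ((F \ U) ∪ W))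
      (boxSources d L A) =
      ∑' n : Current (freeBoxGraph d L),
        if n.sources = boxSources d L A ∧ ∀ e ∈ (F \ U) ∪ W, e ∉ liftBonds d L n.traced
        then n.weight β else 0 := by
    unfold plusCurrentSumAvoid
    refine tsum_congr fun n => if_congr ?_ rfl rfl
    rw [h1 n, forall_freeBoxBonds_eq_zero_iff]
  rw [h2, mul_div_assoc]

open Classical in
/-- **Convergence of `P^A_{Λ_L,β}[n̂ ∩ F = U]`** for `β > 0`, `#A` even, a finite set `F` of lattice
bonds and all `U ⊆ F` (finite signed combination of convergent avoidance probabilities). [cite: AizenmanDuminilCopinSidoraviciusCMP2015, Thm. 2.3 (R1), proof] -/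
theorem exists_tendsto_sourcedTrace {β : ℝ} (hβ : 0 < β) {A : Finset (Site d)} (heven : Even #A)
    {F : Finset (Sym2 (Site d))} (hF : ↑F ⊆ (zdGraph d).edgeSet) :
    ∃ l : Finset (Sym2 (Site d)) → ℝ, ∀ ⦃U : Finset (Sym2 (Site d))⦄, U ⊆ F →
      Tendsto (fun L : ℕ => (∑' n : Current (freeBoxGraph d L),
          if n.sources = boxSources d L A ∧ ∀ e ∈ F, (e ∈ U ↔ e ∈ liftBonds d L n.traced)
          then n.weight β else 0) / currentSum (freeBoxGraph d L) β (boxSources d L A)) atTop (𝓝 (l U)) := by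
  refine ⟨fun U => ∑ W ∈ U.powerset, (-1 : ℝ) ^ #W *
    ((∑ R ∈ ((F \ U) ∪ W).powerset, Real.cosh β ^ #((F \ U) ∪ W) * (-Real.sinh β) ^ #R /
        Real.cosh β ^ #R * freeCorr d β 0 (A ∆ bondsSupport d R)) / freeCorr d β 0 A), fun U hUF => ?_⟩
  simp_rw [sourcedTrace_eq_sum d _ β A hUF]
  refine tendsto_finsetSum _ fun W hW => (tendsto_sourcedAvoid d hβ ?_ heven).const_mul _
  rw [Finset.mem_powerset] at hW
  intro e he
  rw [Finset.coe_union, Set.mem_union, Finset.mem_coe, Finset.mem_coe, Finset.mem_sdiff] at he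
  rcases he with ⟨he, -⟩ | he
  · exact hF he
  · exact hF (hUF (hW he))

/-! ### The sourced double current on the cylinders `{ω ∩ F = U}` -/

open Classical in
/-- **The sourced double current factorises on cylinders** (`P^{A,B}_{Λ,β} = P^A_{Λ,β} ⊗ P^B_{Λ,β}`,
ADC21 §3.1, read on the trace `n̂₁ ∪ n̂₂`): for `β ≥ 0`, nonvanishing normalisers and `U ⊆ F`,
`P^{A,B}_{Λ_L,β}[ω ∩ F = U] = ∑_{U₁,U₂ ⊆ U, U₁ ∪ U₂ = U} P^A_{Λ_L,β}[n̂₁ ∩ F = U₁] · P^B_{Λ_L,β}[n̂₂ ∩ F = U₂]`. [cite: AizenmanDuminilCopinAnnals2021, §3.1] -/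
theorem sourcedDoubleCurrentLaw_real_localCylinder_eq (L : ℕ) {β : ℝ} (hβ : 0 ≤ β)
    {A B : Finset (Site d)}
    (hZA : currentSum (freeBoxGraph d L) β (boxSources d L A) ≠ 0)
    (hZB : currentSum (freeBoxGraph d L) β (boxSources d L B) ≠ 0)
    {F U : Finset (Sym2 (Site d))} (hUF : U ⊆ F) :
    (sourcedDoubleCurrentLaw d L β A B).real (localCylinder (↑F : Set (Sym2 (Site d))) ↑U) =
      ∑ U₁ ∈ U.powerset, ∑ U₂ ∈ U.powerset, if U₁ ∪ U₂ = U then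
        ((∑' n : Current (freeBoxGraph d L),
            if n.sources = boxSources d L A ∧ ∀ e ∈ F, (e ∈ U₁ ↔ e ∈ liftBonds d L n.traced)
            then n.weight β else 0) / currentSum (freeBoxGraph d L) β (boxSources d L A)) *
        ((∑' n : Current (freeBoxGraph d L),
            if n.sources = boxSources d L B ∧ ∀ e ∈ F, (e ∈ U₂ ↔ e ∈ liftBonds d L n.traced)
            then n.weight β else 0) / currentSum (freeBoxGraph d L) β (boxSources d L B))
      else 0 := by
  set G := freeBoxGraph d L with hG
  set A' := boxSources d L A with hA'def
  set B' := boxSources d L B with hB'def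
  set ZA := currentSum G β A' with hZAdef
  set ZB := currentSum G β B' with hZBdef
  have hZ : ZA * ZB ≠ 0 := mul_ne_zero hZA hZB
  have hmeasS := measurableSet_localCylinder_coe d F (↑U : Set (Sym2 (Site d)))
  have hE : MeasurableSet (sourcedTrace d L ⁻¹' localCylinder (↑F : Set (Sym2 (Site d))) ↑U) :=
    (Set.to_countable _).measurableSet
  -- the law as a series
  have hreal : (sourcedDoubleCurrentLaw d L β A B).real (localCylinder (↑F : Set (Sym2 (Site d))) ↑U) =
      (∑' p : Current G × Current G, pairWeight G β A' B' p *
        (sourcedTrace d L ⁻¹' localCylinder (↑F : Set (Sym2 (Site d))) ↑U).indicator 1 p) / (ZA * ZB) := by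
    rw [eq_div_iff hZ, measureReal_def, sourcedDoubleCurrentLaw_apply L β A B hmeasS, ← measureReal_def]
    exact doubleCurrentMeasure_real_mul G β hβ A' B' hE hZ
  have hind : ∀ p : Current G × Current G,
      (sourcedTrace d L ⁻¹' localCylinder (↑F : Set (Sym2 (Site d))) ↑U).indicator
        (1 : Current G × Current G → ℝ) p =
      if ∀ e ∈ F, (e ∈ U ↔ e ∈ liftBonds d L p.1.traced ∪ liftBonds d L p.2.traced) then 1 else 0 := by
    intro p
    by_cases h : ∀ e ∈ F, (e ∈ U ↔ e ∈ liftBonds d L p.1.traced ∪ liftBonds d L p.2.traced)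
    · rw [if_pos h, Set.indicator_of_mem, Pi.one_apply]
      rw [Set.mem_preimage, sourcedTrace_eq_union, mem_localCylinder_coe_iff]
      exact h
    · rw [if_neg h, Set.indicator_of_notMem]
      rw [Set.mem_preimage, sourcedTrace_eq_union, mem_localCylinder_coe_iff]
      exact h
  rw [hreal]
  simp_rw [hind]
  -- the summand, with the pair weight factorised and the indicator split
  set f : Finset (Sym2 (Site d)) → Current G → ℝ := fun U₁ n =>
    if n.sources = A' ∧ ∀ e ∈ F, (e ∈ U₁ ↔ e ∈ liftBonds d L n.traced) then n.weight β else 0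
    with hf
  set g : Finset (Sym2 (Site d)) → Current G → ℝ := fun U₂ n =>
    if n.sources = B' ∧ ∀ e ∈ F, (e ∈ U₂ ↔ e ∈ liftBonds d L n.traced) then n.weight β else 0
    with hg
  have hterm : ∀ p : Current G × Current G,
      pairWeight G β A' B' p *
        (if ∀ e ∈ F, (e ∈ U ↔ e ∈ liftBonds d L p.1.traced ∪ liftBonds d L p.2.traced) then (1 : ℝ) else 0) =
      ∑ U₁ ∈ U.powerset, ∑ U₂ ∈ U.powerset, if U₁ ∪ U₂ = U then f U₁ p.1 * g U₂ p.2 else 0 := by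
    intro p
    rw [indicator_trace_union_eq_sum _ _ hUF, pairWeight_eq_mul, Finset.mul_sum]
    refine Finset.sum_congr rfl fun U₁ _ => ?_
    rw [Finset.mul_sum]
    refine Finset.sum_congr rfl fun U₂ _ => ?_
    by_cases h : U₁ ∪ U₂ = U
    · rw [if_pos h, if_pos h]
      have e₁ : f U₁ p.1 = (if p.1.sources = A' then p.1.weight β else 0) *
          (if ∀ e ∈ F, (e ∈ U₁ ↔ e ∈ liftBonds d L p.1.traced) then (1 : ℝ) else 0) := by
        simp only [hf]; rw [ite_zero_mul_ite_zero, mul_one]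
      have e₂ : g U₂ p.2 = (if p.2.sources = B' then p.2.weight β else 0) *
          (if ∀ e ∈ F, (e ∈ U₂ ↔ e ∈ liftBonds d L p.2.traced) then (1 : ℝ) else 0) := by
        simp only [hg]; rw [ite_zero_mul_ite_zero, mul_one]
      rw [e₁, e₂]
      ring
    · rw [if_neg h, if_neg h, mul_zero]
  simp_rw [hterm]
  -- exchange the `tsum` with the finite sums
  have hfle : ∀ U₁ n, |f U₁ n| ≤ n.weight β := fun U₁ n => by
    simp only [hf]; split_ifs
    · rw [abs_of_nonneg (Current.weight_nonneg hβ n)]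
    · rw [abs_zero]; exact Current.weight_nonneg hβ n
  have hgle : ∀ U₂ n, |g U₂ n| ≤ n.weight β := fun U₂ n => by
    simp only [hg]; split_ifs
    · rw [abs_of_nonneg (Current.weight_nonneg hβ n)]
    · rw [abs_zero]; exact Current.weight_nonneg hβ n
  have hprodS : ∀ U₁ U₂, Summable fun p : Current G × Current G => f U₁ p.1 * g U₂ p.2 := by
    intro U₁ U₂
    have h := (summable_currentWeight_holds G β).mul_of_nonneg (summable_currentWeight_holds G β)
      (fun n => Current.weight_nonneg hβ n) (fun n => Current.weight_nonneg hβ n)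
    refine h.of_norm_bounded fun p => ?_
    rw [Real.norm_eq_abs, abs_mul]
    exact mul_le_mul (hfle U₁ p.1) (hgle U₂ p.2) (abs_nonneg _) (Current.weight_nonneg hβ _)
  have hS : ∀ U₁ U₂, Summable fun p : Current G × Current G =>
      if U₁ ∪ U₂ = U then f U₁ p.1 * g U₂ p.2 else 0 := by
    intro U₁ U₂
    by_cases h : U₁ ∪ U₂ = U
    · simp only [if_pos h]; exact hprodS U₁ U₂
    · simp only [if_neg h]; exact summable_zero
  have hfn : ∀ U₁, Summable fun n => ‖f U₁ n‖ := fun U₁ =>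
    Summable.of_nonneg_of_le (fun n => norm_nonneg _) (fun n => by rw [Real.norm_eq_abs]; exact hfle U₁ n)
      (summable_currentWeight_holds G β)
  have hgn : ∀ U₂, Summable fun n => ‖g U₂ n‖ := fun U₂ =>
    Summable.of_nonneg_of_le (fun n => norm_nonneg _) (fun n => by rw [Real.norm_eq_abs]; exact hgle U₂ n)
      (summable_currentWeight_holds G β)
  rw [Summable.tsum_finsetSum (fun U₁ _ => summable_sum fun U₂ _ => hS U₁ U₂), Finset.sum_div]
  refine Finset.sum_congr rfl fun U₁ _ => ?_
  rw [Summable.tsum_finsetSum (fun U₂ _ => hS U₁ U₂), Finset.sum_div]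
  refine Finset.sum_congr rfl fun U₂ _ => ?_
  by_cases h : U₁ ∪ U₂ = U
  · simp only [if_pos h]
    rw [← tsum_mul_tsum_of_summable_norm (hfn U₁) (hgn U₂), div_mul_div_comm]
  · simp only [if_neg h, tsum_zero, zero_div]

/-- Convergent sequences: `𝟙[p] a_L b_L → 𝟙[p] x y` (a fixed proposition `p`). [folklore] -/
theorem tendsto_ite_mul {a b : ℕ → ℝ} {x y : ℝ} (p : Prop) [Decidable p]
    (ha : Tendsto a atTop (𝓝 x)) (hb : Tendsto b atTop (𝓝 y)) :
    Tendsto (fun L => if p then a L * b L else 0) atTop (𝓝 (if p then x * y else 0)) := by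
  by_cases hp : p
  · simp only [if_pos hp]; exact ha.mul hb
  · simp only [if_neg hp]; exact tendsto_const_nhds

/-- **Convergence of the sourced double current on the cylinders over lattice bonds**: for `β > 0`,
`#A`, `#B` even, a finite set `F` of lattice bonds and `U ⊆ F`, `P^{A,B}_{Λ_L,β}[ω ∩ F = U]`
converges as `L → ∞` (product structure and the convergence of the two trace laws; the laws are
normalised as soon as `A, B ⊆ Λ_L`). [cite: AizenmanDuminilCopinSidoraviciusCMP2015, Thm. 2.3 (R1) and §2.3] -/
theorem exists_tendsto_sourcedDoubleCurrentLaw_localCylinder_lattice {β : ℝ} (hβ : 0 < β)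
    {A B : Finset (Site d)} (hA : Even #A) (hB : Even #B) {F U : Finset (Sym2 (Site d))}
    (hF : ↑F ⊆ (zdGraph d).edgeSet) (hUF : U ⊆ F) :
    ∃ l : ℝ, Tendsto (fun L : ℕ =>
      (sourcedDoubleCurrentLaw d L β A B).real (localCylinder (↑F : Set (Sym2 (Site d))) ↑U)) atTop (𝓝 l) := by
  classical
  obtain ⟨lA, hlA⟩ := exists_tendsto_sourcedTrace d hβ hA hF
  obtain ⟨lB, hlB⟩ := exists_tendsto_sourcedTrace d hβ hB hF
  obtain ⟨L₀, hL₀⟩ := exists_forall_subset_box d (A ∪ B)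
  have hlim := tendsto_finsetSum U.powerset fun U₁ hU₁ => tendsto_finsetSum U.powerset fun U₂ hU₂ =>
    tendsto_ite_mul (U₁ ∪ U₂ = U) (hlA ((Finset.mem_powerset.1 hU₁).trans hUF))
      (hlB ((Finset.mem_powerset.1 hU₂).trans hUF))
  refine ⟨_, hlim.congr' ?_⟩
  filter_upwards [eventually_ge_atTop L₀] with L hL
  have hAL : A ⊆ box d L := Finset.subset_union_left.trans (hL₀ L hL)
  have hBL : B ⊆ box d L := Finset.subset_union_right.trans (hL₀ L hL)
  exact (sourcedDoubleCurrentLaw_real_localCylinder_eq d L hβ.le (currentSum_boxSources_pos d hβ hAL hA).ne'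
    (currentSum_boxSources_pos d hβ hBL hB).ne' hUF).symm

/-- The traces of pairs of free box currents are lattice bond configurations. [folklore] -/
theorem sourcedTrace_subset_edgeSet (L : ℕ) (p : Current (freeBoxGraph d L) × Current (freeBoxGraph d L)) :
    sourcedTrace d L p ⊆ (zdGraph d).edgeSet := by
  rw [sourcedTrace_eq_union]
  rintro e (⟨e', he', rfl⟩ | ⟨e', he', rfl⟩)
  · induction e' using Sym2.ind with
    | _ a b =>
      obtain ⟨hG, -⟩ := he'
      rw [Sym2.map_mk, SimpleGraph.mem_edgeSet]
      exact ((SimpleGraph.mem_edgeSet _).1 (SimpleGraph.mem_edgeFinset.1 hG)).1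
  · induction e' using Sym2.ind with
    | _ a b =>
      obtain ⟨hG, -⟩ := he'
      rw [Sym2.map_mk, SimpleGraph.mem_edgeSet]
      exact ((SimpleGraph.mem_edgeSet _).1 (SimpleGraph.mem_edgeFinset.1 hG)).1

/-- Events that agree on lattice configurations have the same `P^{A,B}_{Λ_L,β}`-probability. [folklore] -/
theorem sourcedDoubleCurrentLaw_real_congr_lattice (L : ℕ) (β : ℝ) (A B : Finset (Site d))
    {S S' : Set (BondConfig (Site d))} (hS : MeasurableSet S) (hS' : MeasurableSet S')
    (h : ∀ ω : BondConfig (Site d), ω ⊆ (zdGraph d).edgeSet → (ω ∈ S ↔ ω ∈ S')) :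
    (sourcedDoubleCurrentLaw d L β A B).real S = (sourcedDoubleCurrentLaw d L β A B).real S' := by
  rw [measureReal_def, measureReal_def, sourcedDoubleCurrentLaw_apply L β A B hS,
    sourcedDoubleCurrentLaw_apply L β A B hS']
  have hpre : sourcedTrace d L ⁻¹' S = sourcedTrace d L ⁻¹' S' := by
    ext p
    exact h _ (sourcedTrace_subset_edgeSet d L p)
  rw [hpre]

/-- **Convergence of `P^{A,B}_{Λ_L,β}[ω ∩ F = U]` for every finite `F` and `U ⊆ F`** (`β > 0`, `#A`,
`#B` even): non-lattice pairs are never open, so the cylinder is, on lattice configurations, a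
cylinder over lattice bonds (or empty). [cite: AizenmanDuminilCopinSidoraviciusCMP2015, Thm. 2.3 (R1) and §2.3] -/
theorem exists_tendsto_sourcedDoubleCurrentLaw_localCylinder {β : ℝ} (hβ : 0 < β)
    {A B : Finset (Site d)} (hA : Even #A) (hB : Even #B) {F U : Finset (Sym2 (Site d))} (hUF : U ⊆ F) :
    ∃ l : ℝ, Tendsto (fun L : ℕ =>
      (sourcedDoubleCurrentLaw d L β A B).real (localCylinder (↑F : Set (Sym2 (Site d))) ↑U)) atTop (𝓝 l) := by
  classical
  by_cases hgood : ∀ e ∈ F, e ∉ (zdGraph d).edgeSet → e ∉ U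
  · set F' := F.filter (· ∈ (zdGraph d).edgeSet) with hF'
    set U' := U.filter (· ∈ (zdGraph d).edgeSet) with hU'
    have hF'E : (↑F' : Set (Sym2 (Site d))) ⊆ (zdGraph d).edgeSet := fun e he =>
      (Finset.mem_filter.1 (Finset.mem_coe.1 he)).2
    have hU'F' : U' ⊆ F' := Finset.filter_subset_filter _ hUF
    have heq : ∀ L, (sourcedDoubleCurrentLaw d L β A B).real (localCylinder (↑F : Set (Sym2 (Site d))) ↑U) =
        (sourcedDoubleCurrentLaw d L β A B).real (localCylinder (↑F' : Set (Sym2 (Site d))) ↑U') := by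
      intro L
      refine sourcedDoubleCurrentLaw_real_congr_lattice d L β A B (measurableSet_localCylinder_coe d F ↑U)
        (measurableSet_localCylinder_coe d F' ↑U') fun ω hω => ?_
      rw [mem_localCylinder_coe_iff, mem_localCylinder_coe_iff]
      constructor
      · intro h e he
        rw [hF', Finset.mem_filter] at he
        rw [hU', Finset.mem_filter, h e he.1]
        exact ⟨fun h' => h'.1, fun h' => ⟨h', he.2⟩⟩
      · intro h e he
        by_cases heE : e ∈ (zdGraph d).edgeSet
        · have h1 := h e (by rw [hF', Finset.mem_filter]; exact ⟨he, heE⟩)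
          rw [hU', Finset.mem_filter] at h1
          rw [← h1]
          exact ⟨fun h' => ⟨h', heE⟩, fun h' => h'.1⟩
        · exact ⟨fun heU => absurd heU (hgood e he heE), fun heω => absurd (hω heω) heE⟩
    simp_rw [heq]
    exact exists_tendsto_sourcedDoubleCurrentLaw_localCylinder_lattice d hβ hA hB hF'E hU'F'
  · refine ⟨0, ?_⟩
    push Not at hgood
    obtain ⟨e, heF, heE, heU⟩ := hgood
    have heq : ∀ L, (sourcedDoubleCurrentLaw d L β A B).real (localCylinder (↑F : Set (Sym2 (Site d))) ↑U) = 0 := by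
      intro L
      rw [← measureReal_empty (μ := sourcedDoubleCurrentLaw d L β A B)]
      refine sourcedDoubleCurrentLaw_real_congr_lattice d L β A B (measurableSet_localCylinder_coe d F ↑U)
        MeasurableSet.empty fun ω hω => ?_
      rw [mem_localCylinder_coe_iff, Set.mem_empty_iff_false, iff_false]
      intro h
      exact heE (hω ((h e heF).1 heU))
    simp_rw [heq]
    exact tendsto_const_nhds

/-! ### Assembly -/

/-- **Existence of the infinite-volume sourced double current `P^{A,B}_β`** for every `β > 0` and
all finite `A, B ⊂ ℤ^d` of even cardinality: the laws `P^{A,B}_{Λ_L,β}` (probability measures once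
`A, B ⊆ Λ_L`) have convergent cylinder probabilities, hence (Kolmogorov extension,
`exists_localLimit_of_tendsto_localCylinder`) converge on every local event to a probability
measure. (ADC21 §3.2, resting on ADS15 Thm. 2.3 (R1); here with free boundary condition, read on
the trace of `n₁ + n₂`.) [cite: AizenmanDuminilCopinAnnals2021, §3.2] -/
theorem exists_isSourcedDoubleCurrentLimit {β : ℝ} (hβ : 0 < β) {A B : Finset (Site d)}
    (hA : Even #A) (hB : Even #B) : ∃ μ, IsSourcedDoubleCurrentLimit d β A B μ := by
  classical
  obtain ⟨L₀, hL₀⟩ := exists_forall_subset_box d (A ∪ B)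
  have hprob : ∀ n : ℕ, IsProbabilityMeasure (sourcedDoubleCurrentLaw d (n + L₀) β A B) := by
    intro n
    have hAL : A ⊆ box d (n + L₀) := Finset.subset_union_left.trans (hL₀ _ (Nat.le_add_left L₀ n))
    have hBL : B ⊆ box d (n + L₀) := Finset.subset_union_right.trans (hL₀ _ (Nat.le_add_left L₀ n))
    exact isProbabilityMeasure_sourcedDoubleCurrentLaw hβ.le (currentSum_boxSources_pos d hβ hAL hA).ne'
      (currentSum_boxSources_pos d hβ hBL hB).ne'
  have hcyl : ∀ F U : Finset (Sym2 (Site d)), U ⊆ F → ∃ l : ℝ,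
      Tendsto (fun n : ℕ => (sourcedDoubleCurrentLaw d (n + L₀) β A B).real
        (localCylinder (↑F : Set (Sym2 (Site d))) ↑U)) atTop (𝓝 l) := by
    intro F U hUF
    obtain ⟨l, hl⟩ := exists_tendsto_sourcedDoubleCurrentLaw_localCylinder d hβ hA hB hUF
    exact ⟨l, (Filter.tendsto_add_atTop_iff_nat L₀).2 hl⟩
  choose! q hq using hcyl
  obtain ⟨μ, hμprob, hμ⟩ := exists_localLimit_of_tendsto_localCylinder hprob (q := q)
    fun F U hUF => hq F U hUF
  refine ⟨μ, ⟨hμprob, fun S hS => ?_⟩⟩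
  exact (Filter.tendsto_add_atTop_iff_nat L₀).1 (hμ S hS)

/-- **ADC21 §3.2 / ADS15 Thm. 2.3 (R1) with sources, proved**: discharge of the named fact
`sourcedDoubleCurrent_limit_exists` of `SourcedDoubleCurrents.lean` — for the nearest-neighbour
Ising model on `ℤ^d` (`d ≥ 2`), every `0 < β ≤ β_c(d)` (indeed every `β > 0`) and all finite
`A, B ⊂ ℤ^d` of even cardinality, the finite-volume sourced double currents `P^{A,B}_{Λ_L,β}`
converge on local events to a probability measure. [cite: AizenmanDuminilCopinAnnals2021, §3.2] -/
theorem sourcedDoubleCurrent_limit_exists_holds : sourcedDoubleCurrent_limit_exists d :=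
  fun _ _ hβ _ _ _ hA hB => exists_isSourcedDoubleCurrentLimit d hβ hA hB

end Box

end Literature.Probability.LatticeModels
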